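import Literature.NumberTheory.DiophantineGeometry.BcgpSerreWreathReductionImprimitiveSurfaces
import HarnessLib

/-!
# BCGP 2025, Lemma 10.4.1 at the WREATH residues (type **B**[C₂]) — corrected typed form with the
# similitude of the automorphic lift FIXED

Topic `NumberTheory/DiophantineGeometry`, companion of
`BcgpSerreWreathReductionImprimitiveSurfaces.lean` (named fact
`bcgp_serreWreath_implies_quadraticImprimitiveSurfacesModular`, whose module docstring quotes the
printed statements and explains the two typed brackets; everything said there about the CONCLUSION,
about hypotheses (i)–(iv) at the wreath residues and about the proof dependencies applies verbatim
here). This file records ONE correction found by the provefact audit of that fact (2026-08-17)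
against the arXiv text of the source and states the corrected implication as the CONCLUSION TYPE of
the theorem `bcgp_serreWreathFixedSimilitude_implies_quadraticImprimitiveSurfacesModular_of_serreWreath`,
PROVED from the old fact (so the repair is machine-checked and provably claims no more than the
declaration it corrects). The proving seat minted no fact (D-0026); the corrected statement was then
NAMED `bcgp_serreWreathFixedSimilitude_implies_quadraticImprimitiveSurfacesModular` (verbatim that
conclusion) by a definition proposal of the route side, and the old `∃ μ` declaration is since a
`@[deprecated]` record (`## Review` below). No `sorry`, no new mathematical object.

Source: G. Boxer, F. Calegari, T. Gee, V. Pilloni, *Modularity theorems for abelian surfaces*,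
arXiv:2502.20645 [BoxerCalegariGeePilloni2025]. Locators below are section numbers; "chunk n" is
the n-th file of the arXiv text layer as materialised by `lit read arxiv:2502.20645` (the sibling
files call these pages), in which statements carry a global counter ("Proposition 374" = Prop.
7.5.7, "Theorem 375" = Thm. 7.5.8, "Proposition 370" = Prop. 7.5.3, "Lemma 437" = Lemma 10.4.1,
"Corollary 337" = Cor. 7.1.4).

## The point: the `GL₄` proxy left the similitude free

In the first bracket of `bcgp_serreWreath_implies_quadraticImprimitiveSurfacesModular` the
automorphic lift `(Π, r)` supplied at a residue `ρ̄` is only asked to be symplectic for SOME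
multiplier, `∃ μ, r.IsSymplecticWithMultiplierFun μ`. The printed hypothesis it stands for fixes the
similitude:

* Lemma 10.4.1 (chunk 146): *"there exists an ordinary cuspidal automorphic representation `π` of
  `GSp₄/ℚ` of regular weight, level prime to `p`, and central character `|·|²`, such that
  `ρ̄_{π,p} ≅ ρ̄`"*;
* the standing convention of the source, §1 (chunk 9): *"We will always assume that such a `π` has
  central character `|·|²`. (We apologize for this assumption, which seemed helpful at some points
  when writing [BCGP 2021], and suffices for applications to abelian surfaces.)"*;
* the theorem the lemma feeds (proof of Lemma 10.4.1: "We now deduce the modularity of `A` as a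
  consequence of Theorem [7.5.8] for `ρ = ρ_{A,p}` … it suffices to check that hypotheses (1)–(5)
  and … of Proposition [7.5.7] hold"), Prop. 7.5.7 (chunk 118): *"`ν ∘ ρ = ε⁻¹`"* and *"there
  exists an ordinary cuspidal automorphic representation `π` of `GSp₄/ℚ` with central character
  `|·|²` such that: `ρ̄_{π,p} ≃ ρ̄`; … there is a compatible choice of `p`-stabilizations of `π_p` and
  `ρ|_{G_{ℚ_p}}` such that `ρ_{π,p}|_{G_{ℚ_p}}` lies on a unique component of `Spec R_p^△` and
  `ρ|_{G_{ℚ_p}}` lies on the same component"* — `ρ` and `ρ_{π,p}` are points of ONE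
  fixed-similitude (`ε⁻¹`) deformation problem.

So the printed input is `ρ_{π,p}` symplectic with multiplier EXACTLY `ε⁻¹` and `ρ̄_{π,p} ≅ ρ̄` as
`GSp₄`-valued representations of that similitude.

## Why it matters exactly at the wreath residues

A type-**B**[C₂] residue is induced and irreducible: `ρ̄ = Ind_{Γ_K}^{Γ_ℚ} σ̄` (`[K : ℚ] = 2`,
`σ̄` the residue of one factor / one `λ`-adic piece over `K`, `det σ̄ = ε̄⁻¹|_{Γ_K}`). Write `χ_K`
for the quadratic character of `K`. Then, with `W' = σ̄^∨`,
`∧²(ρ̄^∨) = [∧²W' ⊕ ∧²W'ᶜ] ⊕ [W' ∧ W'ᶜ] ⊇ Ind_{Γ_K}^{Γ_ℚ}(det σ̄^∨) = ε̄ ⊗ (1 ⊕ χ_K) = ε̄ ⊕ ε̄χ_K`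
as `Γ_ℚ`-SUBmodules (`p` odd), so `ρ̄` carries non-zero invariant ALTERNATING forms of both
multipliers `ε̄⁻¹` and `ε̄⁻¹χ_K`, non-degenerate because `ρ̄` is irreducible (the radical is
stable): `ρ̄` is `GSp₄`-valued in two inequivalent ways, similitude `ε̄⁻¹` and similitude `ε̄⁻¹χ_K`
(by Schur each class carries a unique form up to scalars). A lift `(Π, r)`, `r ≅ r^∨ ⊗ μ`, has
`ρ̄ ≅ ρ̄^∨ ⊗ μ̄` (Brauer–Nesbitt on the congruence clause), hence `μ̄ ∈ {ε̄⁻¹, ε̄⁻¹χ_K}`, and BOTH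
classes pass every clause of the `∃ μ` bracket: for `K` real the class `ε̄⁻¹χ_K` is odd (compatible
with a regular algebraic `Π` of symplectic type); locally at `p` the ordinary `p`-distinguished
shape does not separate the classes (for `p` split in `K`, `χ_K` is trivial on `Γ_{ℚ_p}`; for `p`
inert the two unramified diagonal characters of the same weight differ exactly by `χ_K|_{Γ_{ℚ_p}}`).
But a lift of class `ε̄⁻¹χ_K` cannot be fed to Prop. 7.5.7: its descent to `GSp₄` (Prop. 7.5.3 (1)
with [Arthur 2013, Thm 1.5.2], [Gee–Taïbi 2019, §2]) has central character `≡ |·|²χ_K`, and every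
modification preserving `ρ̄_{π,p} ≅ ρ̄` preserves the class — a twist `ψ` with `ρ̄ ⊗ ψ̄ ≅ ρ̄` has
`ψ̄ ∈ {1, χ_K}`, so it multiplies the similitude by `ψ² ≡ 1 (mod 𝔪)`; moving in the Hida family is
residually trivial. A repair through `ρ̄ ↦ ρ̄ ⊗ ψ̄` needs a Dirichlet character `ψ` with `ψ² = χ_K`,
which exists iff `K` is real and no prime `≡ 3 (mod 4)` ramifies in `K` (every local component of
`χ_K` has to be even: odd ramified primes `≡ 1 (mod 4)`, `2`-component `1` or `χ₈`; e.g.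
`K = ℚ(√2)`, `ℚ(√5)`, `ℚ(√13)` have such a `ψ`, of order `4` — for `ℚ(√2)` the character mod `16`
with `ψ(5) = i`, `ψ(-1) = 1` —, while `K = ℚ(√3)`, `ℚ(√6)`, `ℚ(√7)`, `ℚ(√11)` have none; this
corrects the example "`ℚ(√2)`" of the 2026-08-17 wording). Where `ψ` exists, `ρ := ρ_{A,p} ⊗ ψ`
with the `χ_K`-form has `ν ∘ ρ = ε⁻¹` EXACTLY (`ψ²` is the Teichmüller lift of `ψ̄² = χ_K`, i.e.
`χ_K` itself), is crystalline of weight `2` and `p`-distinguished for `p ∤ cond ψ`, and two of the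
residual-image hypotheses of Prop. 7.5.7 persist by the source's own lemmas — integrally enormous
(Cor. 7.1.4, second case, applies verbatim: `ρ` is induced from `K`, disjoint from `ℚ(ζ_{p^∞})` =
the compositum with the fixed field of the similitude character `ε⁻¹`, the Zariski closure still
contains `SL₂ × SL₂`, and `ψ̄(g) · (ζ₈, ζ₈⁻¹, -ζ₈, -ζ₈⁻¹)` is regular semisimple) and tidy for
`p ≥ 11` (the image of `G_K` contains scalars `λ` with `ν(λ) = λ² ≠ 1`, the mechanism of
[BoxerEtAl2021, §7.5, Def. "tidy" and the lemma `Δ ⊂ H ⟹ tidy` — "Definition 301", "Lemma 303" of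
the arXiv text layer]) —, whereas "vast"/`GSp₄`-reasonable and the residual-modularity input at
`ρ̄ ⊗ ψ̄` are NOT checked here: on that sub-sector a published road plausibly exists but is not
certified by this file. (For `K` imaginary the class `ε̄⁻¹χ_K` is even, `(ε̄⁻¹χ_K)(c) = +1`, and is
excluded by the oddness of the automorphic multiplier [cite: BellaicheChenevier2011, Thm 1.2]
[cite: BarnetlambEtAl2014, §2.1] — the source's [MR3343873] in the proof of Prop. 7.5.3 —, so there
a witness is induced from `K` and carries the Weil class as well; the defect is the real-quadratic
case, in scope by Remark 10.2.2, which itself records that `Res_{K/ℚ} E` is automorphic for `K` real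
by [cite: FreitasLeHungSiksek2015, Thm 1] and that for `End(A_K) ⊗ ℚ` a real quadratic field the
modularity "remains open in general even for real quadratic fields `K`".)

The weight normalisation needs one remark, which is NOT a second defect (this corrects the
2026-08-17 wording of this paragraph, "a second instance of the same defect"; it agrees with the
sibling `BcgpSerreRegularWeightAbelianSurfacesModular.lean`, `## Review 3`–`## Review 4`). Inside
the class `ε̄⁻¹`, with `r` crystalline and Greenberg-ordinary of a shape `a : Fin 4 → ℕ`, the
multiplier is `ε^{-(1+2s)}χ` with `χ` of `p`-power order, unramified at `p`, and `p - 1 ∣ 2s` (the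
reduction of `χ` is unramified), and the Tate twist `ε^{s}` bringing it to `ε⁻¹χ` keeps `ρ̄` only if
`p - 1 ∣ s`: a witness with `2s ≡ p - 1 (mod 2(p-1))` certifies DIRECTLY, at level prime to `p`
and central character `|·|²`, the printed hypothesis at `ρ̄ ⊗ χ_{p*}` (`χ_{p*} = ε̄^{(p-1)/2}`), not
at `ρ̄` — in the source's normalisation `ρ̄_{π,p} = r̄_π ⊗ ω^{(k+l)/2-2}` for `π` of weight
`(k, l; 2)` and level prime to `p`, where `r_π` is the lattice with Hodge–Tate weights
`{0, l-2, k-1, k+l-3}` (theorem of §1.8.9, chunk 9: `ν ∘ ρ_{π,p} = ε⁻¹`, weights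
`((k+l)/2-1, -(k-l)/2, (k-l)/2+1, 2-(k+l)/2)`), and a twist by a lift of `χ_{p*}` is no way out
(ramified at `p`: level `p²`, and `ρ_{A,p} ⊗ χ_{p*}` is not semistable at `p`). But such a witness
CONVERTS into a printed witness AT `ρ̄` by published Hida theory at level prime to `p`: its descent
`π` (weight `(k, l)`, `k ≡ l ≡ 2 (mod p-1)`, level `Γ_N` for some `N ≥ 3` prime to `p`) is a
classical point of the ordinary cuspidal family over the FULL weight space `ℤ_p⟦T(ℤ_p)⟧`
[cite: Pilloni2012, Thm 1.1 (1), (6), (7) (p. 337)] (`V^{ord}_{cusp}` is free of finite rank over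
`Λ_Q` and specialises to `e S(κ, Γ_N, ℤ_p)` at every very regular `κ`; a classical ordinary cusp
form of any weight embeds by (1)), whose localisation at the maximal ideal of `ρ̄` (the residue of
`r_π`, constant on the family) is then free and non-zero, so it has classical ordinary cuspidal
eigenforms of level `Γ_N` — no level at `p` — at every very regular weight `(k', l') ≡ (2, 2)
(mod p-1)`; at those with `k' ≡ l' (mod 2(p-1))` and `k' - l' ≥ 4` (so that the ordinary `π'_p` is
an irreducible unramified principal series, as in the proof of the lemma on `dim_E (M/𝔮'M)[1/p]`,
chunk 118) the `|·|²`-normalised residue is `ρ̄ ⊗ ω^{(k'+l')/2-2} = ρ̄`, the form is of general type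
(`ρ̄` irreducible), and the `p`-power-order part of its central character is removed by an odd-order
twist unramified at `p`: the PRINTED hypothesis at `ρ̄`. So the clause `p - 1 ∣ s` of the corrected
statement below is a NORMALISATION — what the printed `π` gives (§"The repair" (a)) and what gives the
printed `π` back by the single twist `ε^{s}` with no Hida theory ((b)) —, not the repair of an
over-claim: the over-claim of the `∃ μ` form is the similitude CLASS alone.

Hence the `∃ μ` bracket accepts witnesses from which the printed proof cannot be run, and
`bcgp_serreWreath_implies_quadraticImprimitiveSurfacesModular` is NOT [proof of Lemma 10.4.1] ∘
[the descent package recorded in `BcgpSerreRegularWeightAbelianSurfacesModular.lean`]: it is a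
stronger statement than the source proves (conjecturally true, as every statement whose conclusion
is the expected modularity of abelian surfaces, but not literature; `## Review` below says exactly on
which surfaces it exceeds the published record). The same clause occurs in the sibling facts
`bcgp_serreRegularWeight_implies_allAbelianSurfacesModular` (its second bracket contains the
type-**B**[C₂] surfaces: same defect; meanwhile a `@[deprecated]` record, see that file's
`## Verdict clean-up`) and `bcgp_serreSurjective_quadraticImprimitive_implies_endTrivialSurfacesModular`
(type-**A** residues have a unique similitude class, `ρ̄ ⊗ η ≇ ρ̄` for `η ≠ 1`, and the Tate-parity
normalisation is restored by Hida theory as in the previous paragraph: that fact is UNAFFECTED — this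
corrects the 2026-08-17 wording "only the `p - 1 ∣ s` normalisation is at issue").

## The repair

The corrected statement (the conclusion of
`bcgp_serreWreathFixedSimilitude_implies_quadraticImprimitiveSurfacesModular_of_serreWreath`; to be
named `bcgp_serreWreathFixedSimilitude_implies_quadraticImprimitiveSurfacesModular` by a definition
proposal) is VERBATIM the old declaration except that `∃ μ, r.IsSymplecticWithMultiplierFun μ` becomes
`∃ s : ℕ, p - 1 ∣ s ∧ r.IsSymplecticWithMultiplierFun (g ↦ ε_p(g)^{-(1+2s)})`, the multiplier being
EXACTLY an odd power of the `p`-adic cyclotomic character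
(`Literature.NumberTheory.GaloisRepresentations.GaloisRep.cyclotomicCharacter ℚ p`, pushed along
`ℤ_p → ℚ_p → ℚ̄_p` exactly as in `FramedGaloisRep.isCrystallineOrdinaryOfShapeAt_iff`) with
`p - 1 ∣ s`.

* (a) The printed hypothesis IMPLIES the repaired bracket at every residue, so the repaired fact is
  still a reading of Lemma 10.4.1 (Remark 10.4.2 variant) restricted to the wreath residues: given
  the printed `π` (`ω_π = |·|²`, so `ν ∘ ρ_{π,p} = ε⁻¹` exactly; ordinary of regular weight, level
  prime to `p`, `ρ̄_{π,p} ≅ ρ̄`), take `s ∈ (p-1)ℕ` exceeding the Hodge–Tate weights of `ρ_{π,p}` and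
  the pair (transfer of `π` to `GL₄` — cuspidal and C-algebraic, Remark 1.8.13 — Tate-twisted by the
  corresponding power of `|det|`, `r = ρ_{π,p} ⊗ ε^{-s}`): regular algebraic, unramified at `p`,
  multiplier exactly `ε^{-(1+2s)}`, Greenberg-ordinary of an injective shape in `ℕ⁴`, cofinite
  Satake–Frobenius matching, and `r̄ = ρ̄ ⊗ ε̄^{-s} = ρ̄`.
* (b) A repaired witness converts to the printed one by published results only: `r ⊗ ε^{s}` has
  multiplier exactly `ε⁻¹` and reduces to `ρ̄` (`p - 1 ∣ s`); the correspondingly twisted `Π` is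
  regular algebraic cuspidal, unramified at `p`, self-dual up to `|·|²` in the source's
  normalisation, hence of symplectic type (Prop. 7.5.3 (1)) and descends [Arthur 2013, Thm 1.5.2]
  [Gee–Taïbi 2019, §2] to a `π` of general type with central character `|·|²`, level prime to `p`,
  regular weight, ordinary at `p` by crystalline local–global compatibility — the descent package
  of `BcgpSerreRegularWeightAbelianSurfacesModular.lean` with the similitude now accounted for.

So the repaired implication IS [proof of Lemma 10.4.1, type **B**[C₂], with Remark 10.4.2] ∘
[descent] + [Theorem 10.2.1] + [Faltings, Satz 3–4] (the module docstring of the companion file,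
sections TYPED FORM and WHICH PRINTED RESULT COVERS WHICH SURFACE, applies word for word), its
hypothesis is not asserted, and it follows from the old declaration
(`…_of_serreWreath`, proved below: a fixed-similitude witness is an `∃ μ` witness). Consumers should
take the corrected statement as their hypothesis (once named,
`(h : bcgp_serreWreathFixedSimilitude_implies_quadraticImprimitiveSurfacesModular)`); the line lead
of route `Langlands/AbelianSurfaceSerre` should pin the similitude in the body of
`RegularSerreAbelianSurfaces.OrdinarySerreGSp4` in the same way (a `Literature` file does not touch
`Theses`). A discharge remains a theory (Thm. 7.5.8 with Prop. 7.5.7 = §§2–7 of the source; Thm.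
10.2.1; [BCGP 2021, §9.2]; Arthur's transfer; Faltings — of which only Faltings exists in the tree,
as the unproved named facts `Literature.AlgebraicGeometry.Motives.faltings_tate_bijective` and
`Literature.AlgebraicGeometry.Motives.isSemisimpleRepresentation_rationalTateRep`).

## Status (provefact seat of the named fact, 2026-08-17): faithful, XL, conditional in print

Outcome of the discharge attempt for
`bcgp_serreWreathFixedSimilitude_implies_quadraticImprimitiveSurfacesModular` (unit
`provefact-Literature.NumberTheory.DiophantineGeome-f4d5b769a2`); nothing below changes a
declaration.

* AUDIT (statement re-read against chunks 6, 9, 118–120, 138–139, 146 of the arXiv text layer):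
  faithful. The fixed-similitude clause is implied by the printed `π` (§1.8.9, "Theorem 3" of chunk
  9: `ν ∘ ρ_{π,p} = ε⁻¹` for every weight `(k_v, l_v; 2)`, Hodge–Tate weights
  `((k+l)/2 − 1, −(k−l)/2, (k−l)/2 + 1, 2 − (k+l)/2)`, so `r = ρ_{π,p} ⊗ ε^{-s}`, `s ∈ (p−1)ℕ`
  large, is a witness) and converts back by `r ⊗ ε^{s}` and descent, as in §§"The repair" (a), (b);
  hypotheses (i)–(iv) hold at `ρ̄_{A,p}` for the good primes of chunk 146; the conclusion (one
  cuspidal L-algebraic factor on `GL₄`, `m = 1`) is right on the whole second bracket because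
  `V_p A` is absolutely irreducible over `ℚ` when `End_ℚ(A) = ℤ` (Faltings). No misstatement found;
  no corrected restatement is proposed.
* TRIAGE XL; no discharge, no partial proof. The printed proof of `H → C` is, step by step:
  (S0) sort the second bracket by Galois type — Faltings, Satz 3 and Satz 4 / Korollar 1 over the
  quadratic field `K` (`End_K(A) ≠ ℤ`, type ≠ **A**) and the classification of Galois types
  [Fité–Kedlaya–Rotger–Sutherland 2012] used on p. 138–139; (S1) every type other than **B**[C₂]:
  Theorem 10.2.1 (chunks 138–139: [Khare–Wintenberger] for the `GL₂`-type constituents, Lemma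
  "potabmod" for the potentially abelian irreducible ones); (S2) type **B**[C₂]: good primes of
  density one [BoxerEtAl2021, §9.2] and chunk 146 (`ρ̄_{A,p}(Γ_K) = Δ_p`,
  `ρ̄_{A,p}(Γ_{ℚ(ζ_{p^∞})}) = SL₂(𝔽_p) ≀ ℤ/2`, `A` ordinary and residually `p`-distinguished,
  `K ⊄ ℚ(ζ_p)`), i.e. `ρ̄_{A,p}` satisfies the first bracket's residue conditions; (S3) the first
  bracket at `ρ̄ = ρ̄_{A,p}`, the twist `ε^{s}` and the descent `GL₄ → GSp₄` (Prop. 7.5.3 (1),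
  [Arthur2013, Thm 1.5.2], [GeeTaibi2019, §2]); (S4) hypotheses (1)–(5), "integrally enormous",
  "regular semisimple element outside `Sp₄(𝔽_p)`" and "same component of `Spec R_p^△`" of Prop.
  7.5.7 for `ρ = ρ_{A,p}` (chunk 146, Cor. 7.1.4, [BoxerEtAl2021] irreducibility of
  `Spec R_p^△[1/p]`); (S5) Theorem 7.5.8, second alternative (chunk 120: "the Zariski closure of
  `ρ(G_ℚ)` contains `SL₂ × SL₂`, and `ρ` is irreducible but becomes reducible on some index two
  subgroup `G_E`. Then `ρ` is modular") — §§2–7 of the source (higher Hida and Coleman theory,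
  Taylor–Wiles patching, multiplicity one, classicity); (S6) transfer of the resulting `π` on
  `GSp₄` to an L-algebraic cuspidal `Π` on `GL₄` with Satake–Frobenius matching at the good prime
  `p`, then at EVERY prime, basis and frame of the second bracket by the `ℚ`-rationality and
  `ℓ`-independence of the Frobenius characteristic polynomials of `V_ℓ A` (Weil; Serre–Tate 1968,
  Thm. 3; SGA 7 IX). Of (S0)–(S6) only the two Faltings facts named above EXIST in the tree
  (unproved); (S1), (S2), (S4), (S5), (S6) are theories absent from Mathlib and from `Literature/`,
  and (S5) alone is the main theorem of the source.
* REDUCTION LANDED (same seat, 2026-08-17, `BcgpSerreWreathFixedSimilitudeImprimitiveSurfacesProofs.lean`):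
  `bcgp_serreWreathFixedSimilitude_implies_quadraticImprimitiveSurfacesModular_of_modularityLifting_of_goodPrimes_of_remainingTypes`
  PROVES this fact from its three printed ingredients stated as binders in the tree's vocabulary —
  `h758` = (S3)–(S6): Thm. 7.5.8 with Prop. 7.5.7 at `ρ = ρ_{A,p}` for `A` of type **B**[C₂] at a prime
  `p > 5` split in `E` of good ordinary reduction with the residual images of p. 146, residual
  modularity (verbatim the consequent of the first bracket below) ⟹ `A` modular at every prime — the
  EXACT missing input, drafted as the named fact `bcgp_modularityLifting_typeBC2_abelianSurface`
  (file ready; a proving seat may not file it, D-0026, so it awaits the vend-from-binder channel);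
  `hgood` = (S2): the supply of such primes with a residue satisfying both `h758`'s residual hypotheses
  and the residue conditions of the first bracket [BoxerEtAl2021, §9.2, Lemma 9.2.2, 9.2.5; p. 146];
  `h1021` = (S0)–(S1): Theorem 10.2.1 for the surfaces of the second bracket not of type **B**[C₂]
  (`End_ℚ(A) = ℤ`, quadratically imprimitive `H¹` — not of type **A** by Faltings). The glue is the
  printed proof (case split on the Galois type; a framed dual of `V_{p₁} A`; `k` = an algebraic closure
  of the residue field of `𝒪_{ℚ̄_{p₁}}`). A discharge `…_holds` is that theorem applied to the three
  discharged binders — nothing else remains on this side.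
* CONDITIONAL IN PRINT. §1.6 of the source (chunk 6): *"this paper, as with the paper [BCGP],
  relies on results stated by Arthur in [MR2058604] which ultimately rely on references [A24],
  [A25], [A26], and [A27] which have not (still) yet appeared, as well as cases of the twisted
  weighed fundamental lemma announced in [MR2735371]. … As a result of the recent preprint of Atobe,
  Gan, Ichino, Kaletha, Mínguez, and Shin, a complete proof of all the missing ingredients from
  Arthur's papers is now available, and thus the only result we use for which a proof is not yet
  available is the twisted weighted fundamental lemma."* Steps (S3), (S5), (S6) depend on Arthur's
  classification for `GSp₄`, hence on the twisted weighted fundamental lemma; (S0), (S1) do not.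
  Consumers `(h : bcgp_serreWreathFixedSimilitude_implies_quadraticImprimitiveSurfacesModular)`
  inherit this standing hypothesis of the source together with the (unasserted) first bracket.

## Review (provefact seat of the `∃ μ` record, cycle 4, 2026-08-17): where the over-claim bites; record deprecated

The comparison "which `∃ μ` witnesses at a wreath residue convert, by published results, into a
witness of the PRINTED hypothesis at the same `ρ̄`" was re-derived independently and then reconciled
with the sibling `BcgpSerreRegularWeightAbelianSurfacesModular.lean`, `## Review 3`–`## Review 4`,
with which it agrees. Re-read for it: chunks 9, 104–105 (Def. 7.1.1 "integrally enormous", the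
lemma and Cor. 7.1.4 after it — "Definition 334", "Lemma 335", "Corollary 337" of the text layer),
118–119, 139 ("Remark 426" = Rem. 10.2.2) and 146 of the source; [BoxerEtAl2021], arXiv text layer
chunk 124 (Def. "tidy", the lemma `Δ ⊂ H ⟹ tidy`, and §7.5.2: for `W` absolutely irreducible and
reducible on an index-two subgroup, `∧²W = k ⊕ k(χ) ⊕ Asai(V) ⊗ χ` — the two similitude classes in
the source's own words); [Pilloni2012], pp. 336–338 (Thm 1.1, Thm 1.2). Nothing below changes a
declaration's statement.

* VERDICT UNCHANGED: the record `bcgp_serreWreath_implies_quadraticImprimitiveSurfacesModular` is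
  MISSTATED — stronger than the source — through the similitude CLASS of the automorphic lift, and
  through it alone (§"Why it matters": the Tate-parity remark is a normalisation, not a defect; the
  corrected named fact of this file is faithful, `## Status`).
* WHERE IT BITES. A witness of the class `ε̄⁻¹χ_K` needs `K` real (sign theorem). Of the surfaces of
  the second bracket of type **B**[C₂] with `K` real: `A_K ∼ E × E^c` (`E/K` an elliptic curve, no
  CM, `E ≁ E^c`) is automorphic outright ([cite: FreitasLeHungSiksek2015, Thm 1] with automorphic
  induction; Rem. 10.2.2 of the source), so there the CONCLUSION holds; for `χ_K` a Dirichlet square a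
  road through `ρ_{A,p} ⊗ ψ` plausibly exists (§"Why it matters"; not certified here). What is left
  with NO published road from an `∃ μ` witness: `A/ℚ` of type **B**[C₂] with `A_K` simple (real
  multiplication by the real quadratic field `End(A_K) ⊗ ℚ`, defined over `K` only) and `K` real —
  certainly when a prime `≡ 3 (mod 4)` ramifies in `K` (`K = ℚ(√3), ℚ(√6), ℚ(√7), …`), and, as long
  as the image hypotheses of the `ψ`-road are unverified, for every real `K`. Such surfaces exist and
  their modularity "remains open in general" (Rem. 10.2.2, with the example `E = K = ℚ(√5)`); on
  them the record is neither Lemma 10.4.1 along its proof nor, as far as the published record goes,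
  a theorem.
* TREATMENT (human ruling 2026-08-15, "restate by default", as executed for the sibling record by its
  verdict clean-up). The corrected statement is the named fact
  `bcgp_serreWreathFixedSimilitude_implies_quadraticImprimitiveSurfacesModular` below; the record keeps
  its body and its ledger-referenced name and becomes `@[deprecated]` in its own file (proposal of the
  same seat, 2026-08-17); the two comparison theorems of this file, which must name the record as
  their hypothesis, stay live with `linter.deprecated` switched off for them only. Other users of the
  record: `…/Theorems/AbelianSurfaceSerreQuadraticImprimitiveSurfacesOfOrdinarySerre.lean` and
  `…OfWreathItems.lean` of route `Langlands/AbelianSurfaceSerre` (which has re-based crux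
  stmt-Langlands-17766 on the corrected fact: items stmt-Langlands-18072, stmt-Langlands-18078) and
  the deprecated bookkeeping theorem
  `bcgp_serreRegularWeight_implies_allAbelianSurfacesModular_of_wreath_of_primitive`.

## References

* [BoxerCalegariGeePilloni2025] G. Boxer, F. Calegari, T. Gee, V. Pilloni, *Modularity theorems
  for abelian surfaces*, arXiv:2502.20645: Lemma 10.4.1 with Remark 10.4.2 and its proof (chunk
  146); §1, standing convention on the central character, and the theorem of §1.8.9 recalling
  `ρ_{π,p}` (chunk 9); Def. 7.1.1, Cor. 7.1.4 (chunks 104–105); Prop. 7.5.3 (1) (chunk 117);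
  Prop. 7.5.7 (chunks 118–119); Thm. 7.5.8 (chunk 120); Theorem 10.2.1, Remark 10.2.2 (chunks
  138–139); Remark 1.8.13 and Definition 1.8.12 (chunk 11).
* [BoxerEtAl2021] G. Boxer, F. Calegari, T. Gee, V. Pilloni, *Abelian surfaces over totally real
  fields are potentially modular*, Publ. Math. IHÉS 134 (2021), §9.2; §2 (similitude conventions);
  §7.5 (Def. "tidy"; §7.5.2, `∧²W = k ⊕ k(χ) ⊕ Asai(V) ⊗ χ`).
* [Faltings1983Endlichkeit] G. Faltings, *Endlichkeitssätze für abelsche Varietäten über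
  Zahlkörpern*, Invent. Math. 73 (1983), Satz 3, Satz 4, Korollar 1.
* [Arthur2013] J. Arthur, *The endoscopic classification of representations*, AMS Colloq. Publ. 61,
  Thm 1.5.2.
* [GeeTaibi2019] T. Gee, O. Taïbi, *Arthur's multiplicity formula for GSp₄ and restriction to
  Sp₄*, J. Éc. polytech. Math. 6 (2019), §2.
* [Pilloni2012] V. Pilloni, *Sur la théorie de Hida pour le groupe GSp_{2g}*, Bull. SMF 140 (2012),
  Thm 1.1 (1), (6), (7) (p. 337), Thm 1.2 (p. 338) (§"Why it matters": the Tate-parity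
  normalisation is restored at level prime to `p`; not used by any declaration).
* [BellaicheChenevier2011] J. Bellaïche, G. Chenevier, *The sign of Galois representations attached
  to automorphic forms for unitary groups*, Compos. Math. 147 (2011), Thm 1.2; [BarnetlambEtAl2014]
  T. Barnet-Lamb, T. Gee, D. Geraghty, R. Taylor, *Potential automorphy and change of weight*, Ann.
  of Math. 179 (2014), §2.1 (oddness of the automorphic multiplier: `K` imaginary is not affected).
* [FreitasLeHungSiksek2015] N. Freitas, B. V. Le Hung, S. Siksek, *Elliptic curves over real
  quadratic fields are modular*, Invent. Math. 201 (2015), Thm 1 (`## Review`: the sub-sector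
  `A_K ∼ E × E^c`, `K` real, is automorphic outright).
-/

namespace Literature.NumberTheory.DiophantineGeometry

-- `linter.deprecated` off for the next declaration only: its hypothesis must be the `∃ μ` record
-- `bcgp_serreWreath_implies_quadraticImprimitiveSurfacesModular`, deprecated as misstated (module
-- docstring, `## Review`); this theorem is the certified comparison "corrected ⟸ record".
set_option linter.deprecated false in
/-- **BCGP 2025 Lemma 10.4.1 along its printed proof (type B[C₂] branch), Theorem 10.2.1 and
Faltings — the CORRECTED typed implication (similitude of the automorphic lift FIXED), proved from
the recorded (deprecated, misstated) `∃ μ` form.** The conclusion of this theorem is VERBATIM the named fact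
`bcgp_serreWreath_implies_quadraticImprimitiveSurfacesModular` except for ONE clause of its first
bracket: the lift `r` supplied at a wreath residue `ρ̄` is symplectic with multiplier EXACTLY
`ε_p^{-(1+2s)}` for some `s` with `p - 1 ∣ s` (`ε_p = GaloisRep.cyclotomicCharacter ℚ p` pushed into
`ℚ̄_p` as in `FramedGaloisRep.isCrystallineOrdinaryOfShapeAt_iff`; `s` is the integral Tate shift
putting the Hodge–Tate shape `a` in `ℕ⁴`), instead of "symplectic for SOME multiplier `μ`". This
corrected statement — not the `∃ μ` form — is what [proof of Lemma 10.4.1, type **B**[C₂], Remark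
10.4.2] ∘ [descent `GL₄ → GSp₄`: Prop. 7.5.3 (1), Arthur 2013 Thm 1.5.2, Gee–Taïbi 2019 §2, and the
twist `ε^{s}`] + [Thm. 10.2.1] + [Faltings, Satz 3–4] proves (module docstring: the printed
hypothesis fixes the central character `|·|²`, i.e. `ν ∘ ρ_{π,p} = ε⁻¹`, Prop. 7.5.7; an induced
residue carries the two similitude classes `ε̄⁻¹`, `ε̄⁻¹χ_K` and a lift of the second class, admitted
by `∃ μ`, cannot be used). It is stated here as the CONCLUSION TYPE of a theorem and proved from the
old fact by pure logic (a fixed-similitude witness is an `∃ μ` witness), so that (1) the corrected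
bracket is machine-checked and provably claims no more than the declaration it corrects, and (2) no
unproved named fact is minted by a proving seat (D-0026); the conclusion has since been named
`bcgp_serreWreathFixedSimilitude_implies_quadraticImprimitiveSurfacesModular` (next declaration, at
the request of route `Langlands/AbelianSurfaceSerre`), and the planner of that route should pin the
similitude in `RegularSerreAbelianSurfaces.OrdinarySerreGSp4` the same way. Its hypothesis (first
bracket) is not asserted anywhere.
[cite: BoxerCalegariGeePilloni2025, Lemma 10.4.1 proof (type B[C₂]), Rem. 10.4.2; §1 (central character |·|²); Prop. 7.5.3 (1); Prop. 7.5.7; Thm. 7.5.8; Thm 10.2.1; Rem. 10.2.2; Rem. 1.8.13; Def. 1.8.12]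
[cite: BoxerEtAl2021, §9.2 (big image and good primes of density one for challenging surfaces)]
[cite: Faltings1983Endlichkeit, Satz 3, Satz 4, Korollar 1]
[cite: Arthur2013, Thm 1.5.2 (descent GL₄ → GSp₄ used to read the GL₄ proxy)]
[cite: GeeTaibi2019, §2 (Arthur's classification for GSp₄)] -/
theorem bcgp_serreWreathFixedSimilitude_implies_quadraticImprimitiveSurfacesModular_of_serreWreath
    (h : bcgp_serreWreath_implies_quadraticImprimitiveSurfacesModular) :
    (∃ P₀ : ℕ, ∀ (p : ℕ) [Fact p.Prime], P₀ ≤ p → ∀ (k : Type) [Field k] [CharP k p] [IsAlgClosed k]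
    [TopologicalSpace k] [DiscreteTopology k] (red : Valued.integer (PadicAlgCl p) →+* k) (ρb :
    Literature.NumberTheory.GaloisRepresentations.FramedGaloisRep ℚ k 4),
    ρb.toGaloisRep.IsIrreducible → ρb.IsSymplecticWithMultiplierFun (fun g => (((Units.map
    (ZMod.castHom (dvd_refl p) k).toMonoidHom ((modularCyclotomicCharacter (AlgebraicClosure ℚ)
    (HasEnoughRootsOfUnity.natCard_rootsOfUnity (AlgebraicClosure ℚ) p)).comp
    (MulSemiringAction.toRingAut (Field.absoluteGaloisGroup ℚ) (AlgebraicClosure ℚ)) g))⁻¹ : kˣ) :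
    k)) → (∀ v : IsDedekindDomain.HeightOneSpectrum (NumberField.RingOfIntegers ℚ), ((p : ℕ) :
    NumberField.RingOfIntegers ℚ) ∈ v.asIdeal → ∃ g : Matrix.GeneralLinearGroup (Fin 4) k, (∀ (τ :
    Field.absoluteGaloisGroup (v.adicCompletion ℚ)) (i j : Fin 4), j < i → (g * ρb.toLocal v τ *
    g⁻¹).val i j = 0) ∧ ∀ i j : Fin 4, i ≠ j → ∃ τ : Field.absoluteGaloisGroup (v.adicCompletion ℚ),
    (g * ρb.toLocal v τ * g⁻¹).val i i ≠ (g * ρb.toLocal v τ * g⁻¹).val j j) → Nat.card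
    ρb.toMonoidHom.range = 2 * p ^ 2 * (p - 1) * (p ^ 2 - 1) ^ 2 → (ρb.restrictField
    (CyclotomicField p ℚ)).toGaloisRep.IsIrreducible → (∃ (K : Type) (_ : Field K) (_ : NumberField
    K), Module.finrank ℚ K = 2 ∧ ¬ (ρb.restrictField K).toGaloisRep.IsIrreducible) → ∀ (hcpt :
    Literature.NumberTheory.Automorphic.isCompact_glFiniteIntegralLevel 4 ℚ) (ι : PadicAlgCl p ≃+*
    ℂ), ∃ (π : Literature.NumberTheory.Automorphic.CuspidalAutomorphicRepData 4 ℚ hcpt) (r :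
    Literature.NumberTheory.GaloisRepresentations.FramedGaloisRep ℚ (PadicAlgCl p) 4),
    π.1.IsRegularAlgebraic ∧ (∀ v : IsDedekindDomain.HeightOneSpectrum (NumberField.RingOfIntegers
    ℚ), ((p : ℕ) : NumberField.RingOfIntegers ℚ) ∈ v.asIdeal → π.1.IsUnramifiedAt v) ∧ (∃ s : ℕ,
    (p - 1) ∣ s ∧ r.IsSymplecticWithMultiplierFun (fun g => algebraMap ℚ_[p] (PadicAlgCl p)
    (((((Literature.NumberTheory.GaloisRepresentations.GaloisRep.cyclotomicCharacter ℚ p g)⁻¹ :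
    ℤ_[p]ˣ) : ℤ_[p]) : ℚ_[p]) ^ (1 + 2 * s)))) ∧ (∀ v :
    IsDedekindDomain.HeightOneSpectrum (NumberField.RingOfIntegers ℚ), ((p : ℕ) :
    NumberField.RingOfIntegers ℚ) ∈ v.asIdeal → ∃ a : Fin 4 → ℕ, Function.Injective a ∧
    r.IsGreenbergOrdinaryOfShapeAt v a) ∧ (∀ᶠ v : IsDedekindDomain.HeightOneSpectrum
    (NumberField.RingOfIntegers ℚ) in Filter.cofinite, ∃ α : Multiset ℂ, π.1.HasSatakeParamAt v α ∧
    r.IsUnramifiedAt v ∧ r.HasFrobCharpolyAt v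
    (Literature.NumberTheory.Automorphic.arithFrobPolyOfSatake ι v.residueCard 4 α)) ∧ (∀ᶠ v :
    IsDedekindDomain.HeightOneSpectrum (NumberField.RingOfIntegers ℚ) in Filter.cofinite,
    r.IsUnramifiedAt v ∧ ρb.IsUnramifiedAt v ∧ ∃ (P : Polynomial (Valued.integer (PadicAlgCl p)))
    (Pb : Polynomial k), r.HasFrobCharpolyAt v (P.map (Valued.integer (PadicAlgCl p)).subtype) ∧
    ρb.HasFrobCharpolyAt v Pb ∧ P.map red = Pb)) →
    ∀ (A : Literature.AlgebraicGeometry.Motives.AbelianVariety ℚ), A.dim = 2 → (∀ f : A ⟶ A, ∃ n :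
    ℤ, f = n • CategoryTheory.CategoryStruct.id A) → ∀ (p : ℕ) [Fact p.Prime] (b : Module.Basis (Fin
    4) ℚ_[p] (A.rationalTateModule p)) (r :
    Literature.NumberTheory.GaloisRepresentations.FramedGaloisRep ℚ (PadicAlgCl p) 4), (∀ g :
    Field.absoluteGaloisGroup ℚ, (r g).val = ((LinearMap.toMatrix b b (A.rationalTateRep p g⁻¹)).map
    (algebraMap ℚ_[p] (PadicAlgCl p))).transpose) → (∃ (K : Type) (_ : Field K) (_ : NumberField K),
    Module.finrank ℚ K = 2 ∧ ¬ Literature.NumberTheory.GaloisRepresentations.FramedRep.IsIrreducible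
    (r.restrictField K)) → ∀ (hcpt :
    Literature.NumberTheory.Automorphic.isCompact_glFiniteIntegralLevel 4 ℚ) (ι : PadicAlgCl p ≃+*
    ℂ), ∃ π : Literature.NumberTheory.Automorphic.CuspidalAutomorphicRepData 4 ℚ hcpt,
    π.1.IsLAlgebraic ∧ ∀ᶠ v : IsDedekindDomain.HeightOneSpectrum (NumberField.RingOfIntegers ℚ) in
    Filter.cofinite, ∃ a : Multiset ℂ, π.1.HasSatakeParamAt v a ∧ r.IsUnramifiedAt v ∧
    r.HasFrobCharpolyAt v (Literature.NumberTheory.Automorphic.arithFrobPolyOfSatake ι v.residueCard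
    1 a) := by
  rintro ⟨P₀, hP⟩
  apply h
  refine ⟨P₀, ?_⟩
  intro p _ hp k _ _ _ _ _ red ρb hirr hsymp htri hcard hcyc hK hcpt ι
  obtain ⟨π, r, h1, h2, ⟨s, -, hs⟩, h4, h5, h6⟩ :=
    hP p hp k red ρb hirr hsymp htri hcard hcyc hK hcpt ι
  exact ⟨π, r, h1, h2, ⟨_, hs⟩, h4, h5, h6⟩

/-- **Named form of the corrected implication (BCGP 2025 Lemma 10.4.1 along its printed proof, type
B[C₂] branch, + Thm 10.2.1 + Faltings, similitude of the automorphic lift FIXED).**  VERBATIM the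
conclusion type of `bcgp_serreWreathFixedSimilitude_implies_quadraticImprimitiveSurfacesModular_of_serreWreath`
above (first bracket: the residual-modularity HYPOTHESIS of Lemma 10.4.1 in the Rem. 10.4.2
variant — regular ordinary weight, `GL₄` proxy, `p ≥ P₀` — at the wreath residues `Δ_p ⋊ C₂` — irreducible, symplectic of multiplier `ε̄_p⁻¹`,
residually `p`-distinguished triangularisable at `p`, image of order `2p²(p-1)(p²-1)²`, irreducible on
`Γ_{ℚ(ζ_p)}`, reducible on `Γ_K` for a quadratic `K` — with the lift `r` symplectic of multiplier
EXACTLY `ε_p^{-(1+2s)}`, `p - 1 ∣ s`; second bracket: every abelian surface `A/ℚ` with `End_ℚ(A) = ℤ`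
whose framed dual `p`-adic Tate module `r` is reducible on some quadratic `Γ_K` is modular —
L-algebraic cuspidal `π` on `GL₄/ℚ`, a.e. Satake–Frobenius compatible, `m = 1`).  Named here, as the
module docstring foresees ("may name this conclusion … verbatim (a definition proposal)"), at the
request of the line lead of crux stmt-Langlands-17766 (`AbelianSurfaceSerre.QuadraticImprimitiveSurfaces`),
whose reshaped registered stub `stub_wreathReductionFixed` it is verbatim; the hypothesis (first
bracket) is NOT asserted.  It follows from the recorded `∃ μ` fact
(`…_of_serreWreath'` below, i.e. the theorem above), and — unlike that fact — it is exactly what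
[proof of Lemma 10.4.1, Rem. 10.4.2] ∘ [descent `GL₄ → GSp₄`, Prop. 7.5.3 (1), Arthur 2013 Thm 1.5.2,
Gee–Taïbi 2019 §2, twist `ε^{s}`] + [Thm. 10.2.1] + [Faltings, Satz 3–4] proves (module docstring,
§§"The point", "Why it matters", "The repair").
[cite: BoxerCalegariGeePilloni2025, Lemma 10.4.1 proof (type B[C₂]), Rem. 10.4.2; §1 (central character |·|²); Prop. 7.5.3 (1); Prop. 7.5.7; Thm. 7.5.8; Thm 10.2.1; Rem. 10.2.2; Rem. 1.8.13; Def. 1.8.12]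
[cite: BoxerEtAl2021, §9.2 (big image and good primes of density one for challenging surfaces)]
[cite: Faltings1983Endlichkeit, Satz 3, Satz 4, Korollar 1]
[cite: Arthur2013, Thm 1.5.2 (descent GL₄ → GSp₄ used to read the GL₄ proxy)]
[cite: GeeTaibi2019, §2 (Arthur's classification for GSp₄)] -/
def bcgp_serreWreathFixedSimilitude_implies_quadraticImprimitiveSurfacesModular : Prop :=
    (∃ P₀ : ℕ, ∀ (p : ℕ) [Fact p.Prime], P₀ ≤ p → ∀ (k : Type) [Field k] [CharP k p] [IsAlgClosed k]
    [TopologicalSpace k] [DiscreteTopology k] (red : Valued.integer (PadicAlgCl p) →+* k) (ρb :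
    Literature.NumberTheory.GaloisRepresentations.FramedGaloisRep ℚ k 4),
    ρb.toGaloisRep.IsIrreducible → ρb.IsSymplecticWithMultiplierFun (fun g => (((Units.map
    (ZMod.castHom (dvd_refl p) k).toMonoidHom ((modularCyclotomicCharacter (AlgebraicClosure ℚ)
    (HasEnoughRootsOfUnity.natCard_rootsOfUnity (AlgebraicClosure ℚ) p)).comp
    (MulSemiringAction.toRingAut (Field.absoluteGaloisGroup ℚ) (AlgebraicClosure ℚ)) g))⁻¹ : kˣ) :
    k)) → (∀ v : IsDedekindDomain.HeightOneSpectrum (NumberField.RingOfIntegers ℚ), ((p : ℕ) :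
    NumberField.RingOfIntegers ℚ) ∈ v.asIdeal → ∃ g : Matrix.GeneralLinearGroup (Fin 4) k, (∀ (τ :
    Field.absoluteGaloisGroup (v.adicCompletion ℚ)) (i j : Fin 4), j < i → (g * ρb.toLocal v τ *
    g⁻¹).val i j = 0) ∧ ∀ i j : Fin 4, i ≠ j → ∃ τ : Field.absoluteGaloisGroup (v.adicCompletion ℚ),
    (g * ρb.toLocal v τ * g⁻¹).val i i ≠ (g * ρb.toLocal v τ * g⁻¹).val j j) → Nat.card
    ρb.toMonoidHom.range = 2 * p ^ 2 * (p - 1) * (p ^ 2 - 1) ^ 2 → (ρb.restrictField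
    (CyclotomicField p ℚ)).toGaloisRep.IsIrreducible → (∃ (K : Type) (_ : Field K) (_ : NumberField
    K), Module.finrank ℚ K = 2 ∧ ¬ (ρb.restrictField K).toGaloisRep.IsIrreducible) → ∀ (hcpt :
    Literature.NumberTheory.Automorphic.isCompact_glFiniteIntegralLevel 4 ℚ) (ι : PadicAlgCl p ≃+*
    ℂ), ∃ (π : Literature.NumberTheory.Automorphic.CuspidalAutomorphicRepData 4 ℚ hcpt) (r :
    Literature.NumberTheory.GaloisRepresentations.FramedGaloisRep ℚ (PadicAlgCl p) 4),
    π.1.IsRegularAlgebraic ∧ (∀ v : IsDedekindDomain.HeightOneSpectrum (NumberField.RingOfIntegers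
    ℚ), ((p : ℕ) : NumberField.RingOfIntegers ℚ) ∈ v.asIdeal → π.1.IsUnramifiedAt v) ∧ (∃ s : ℕ,
    (p - 1) ∣ s ∧ r.IsSymplecticWithMultiplierFun (fun g => algebraMap ℚ_[p] (PadicAlgCl p)
    (((((Literature.NumberTheory.GaloisRepresentations.GaloisRep.cyclotomicCharacter ℚ p g)⁻¹ :
    ℤ_[p]ˣ) : ℤ_[p]) : ℚ_[p]) ^ (1 + 2 * s)))) ∧ (∀ v :
    IsDedekindDomain.HeightOneSpectrum (NumberField.RingOfIntegers ℚ), ((p : ℕ) :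
    NumberField.RingOfIntegers ℚ) ∈ v.asIdeal → ∃ a : Fin 4 → ℕ, Function.Injective a ∧
    r.IsGreenbergOrdinaryOfShapeAt v a) ∧ (∀ᶠ v : IsDedekindDomain.HeightOneSpectrum
    (NumberField.RingOfIntegers ℚ) in Filter.cofinite, ∃ α : Multiset ℂ, π.1.HasSatakeParamAt v α ∧
    r.IsUnramifiedAt v ∧ r.HasFrobCharpolyAt v
    (Literature.NumberTheory.Automorphic.arithFrobPolyOfSatake ι v.residueCard 4 α)) ∧ (∀ᶠ v :
    IsDedekindDomain.HeightOneSpectrum (NumberField.RingOfIntegers ℚ) in Filter.cofinite,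
    r.IsUnramifiedAt v ∧ ρb.IsUnramifiedAt v ∧ ∃ (P : Polynomial (Valued.integer (PadicAlgCl p)))
    (Pb : Polynomial k), r.HasFrobCharpolyAt v (P.map (Valued.integer (PadicAlgCl p)).subtype) ∧
    ρb.HasFrobCharpolyAt v Pb ∧ P.map red = Pb)) →
    ∀ (A : Literature.AlgebraicGeometry.Motives.AbelianVariety ℚ), A.dim = 2 → (∀ f : A ⟶ A, ∃ n :
    ℤ, f = n • CategoryTheory.CategoryStruct.id A) → ∀ (p : ℕ) [Fact p.Prime] (b : Module.Basis (Fin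
    4) ℚ_[p] (A.rationalTateModule p)) (r :
    Literature.NumberTheory.GaloisRepresentations.FramedGaloisRep ℚ (PadicAlgCl p) 4), (∀ g :
    Field.absoluteGaloisGroup ℚ, (r g).val = ((LinearMap.toMatrix b b (A.rationalTateRep p g⁻¹)).map
    (algebraMap ℚ_[p] (PadicAlgCl p))).transpose) → (∃ (K : Type) (_ : Field K) (_ : NumberField K),
    Module.finrank ℚ K = 2 ∧ ¬ Literature.NumberTheory.GaloisRepresentations.FramedRep.IsIrreducible
    (r.restrictField K)) → ∀ (hcpt :
    Literature.NumberTheory.Automorphic.isCompact_glFiniteIntegralLevel 4 ℚ) (ι : PadicAlgCl p ≃+*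
    ℂ), ∃ π : Literature.NumberTheory.Automorphic.CuspidalAutomorphicRepData 4 ℚ hcpt,
    π.1.IsLAlgebraic ∧ ∀ᶠ v : IsDedekindDomain.HeightOneSpectrum (NumberField.RingOfIntegers ℚ) in
    Filter.cofinite, ∃ a : Multiset ℂ, π.1.HasSatakeParamAt v a ∧ r.IsUnramifiedAt v ∧
    r.HasFrobCharpolyAt v (Literature.NumberTheory.Automorphic.arithFrobPolyOfSatake ι v.residueCard
    1 a)

-- `linter.deprecated` off for the next declaration only: its hypothesis must be the deprecated record.
set_option linter.deprecated false in
/-- **The corrected named fact follows from the recorded (deprecated, misstated) `∃ μ` fact** (a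
fixed-similitude witness is an `∃ μ` witness):
`bcgp_serreWreathFixedSimilitude_implies_quadraticImprimitiveSurfacesModular_of_serreWreath`
read through the name. [cite: BoxerCalegariGeePilloni2025, Lemma 10.4.1 proof (type B[C₂]), Rem. 10.4.2] -/
theorem bcgp_serreWreathFixedSimilitude_implies_quadraticImprimitiveSurfacesModular_of_serreWreath'
    (h : bcgp_serreWreath_implies_quadraticImprimitiveSurfacesModular) :
    bcgp_serreWreathFixedSimilitude_implies_quadraticImprimitiveSurfacesModular :=
  bcgp_serreWreathFixedSimilitude_implies_quadraticImprimitiveSurfacesModular_of_serreWreath h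

end Literature.NumberTheory.DiophantineGeometry
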